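import Literature.AnabelianGeometry.SemiGraphs.SgAGlobalPointSystem
import Literature.AnabelianGeometry.SemiGraphs.VertexAlignedStabilizers
import Literature.AnabelianGeometry.SemiGraphs.EdgeAlignedStabilizers
import Literature.AnabelianGeometry.SemiGraphs.EdgeSectionMono
import HarnessLib

/-!
# [SemiAnbd] Rem. 2.2.1 for an ABSTRACT four-clause covering, read on profinite presentations: the
# STABILISER DICTIONARY (PS2) at the global points (bridge brick L1-glob, proof-only companion)

Mochizuki, *Semi-graphs of anabelioids*, Publ. RIMS **42** (2006), Rem. 2.2.1 p. 24 ("the image of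
each `Π_v` [resp. `Π_b`] of `Π_𝒢` is equal to the stabilizer of a compatible system of vertices [resp.
branches]"), Def. 2.2 (i) p. 23 (the covering attached to `G' ∈ Ob(B(𝒢))`), Def. 3.5 (i)/(ii) p. 37
(kurims `paper:url-f33ace170ff4`). [cite: MochizukiSemiAnbd2006, Rem. 2.2.1 p.24]

PROOF-ONLY companion of `SgAGlobalPointSystem.lean` (abc-iut-L3-t3, (R1) bridge law L1 for the cell's
ABSTRACT four-clause coverings, HOME/staging/L3/L3-t3/R1-BRIDGE-SHAPES.md §5).  There the GLOBAL points
`y_w`, `z_{e'}` of a covering `ψ : ℋ → 𝒦` with a global witness were shown to satisfy (PS3) point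
alignment and (PS1) the gluing condition with NO alignment clause.  Here, the stabiliser dictionary
(PS2) `CovObj.StabCondition` — the one place where the ALIGNMENT clauses of the cell's covering notion of
record `Hom.IsFiniteEtaleCoveringGlobal` = «local ∧ global ∧ branch-aligned ∧ vertex-aligned» enter:

* `stabilizer_map_autMulEquivOfIso` — stabilisers transport along a change of basepoint (abc-iut-w4-d079's
  `range_autMulEquivOfIso_refl_comp` strips the identity change);
* `Hom.range_hVProfinite_eq_stabilizer_yGlob` — **(PS2) at vertices**: the image of
  `Π_{ℋ,w} → Π_{𝒦,u}` is `Stab(y_w)` — the LOCAL clause (abc-iut-L3-t3 L1a: image = stabiliser of the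
  local base point), (D1) at the canonical basepoint (abc-iut-w4-d071 `range_pi1Map_eq_stabilizer'`) and
  VERTEX ALIGNMENT (abc-iut-w4-d079 `IsVertexAligned.stabilizer_eq_of_ranges`);
* `Hom.range_hEAt_eq_stabilizer_zGlobAt` / `…_zGlob` — **(PS2) at edges with an abutting branch**:
  BRANCH ALIGNMENT (abc-iut-f-161 `IsBranchAligned.edge_stabilizer_eq_of_global`: the transported global
  vertex point and the local edge base point have equal stabilisers) and abc-iut-w4-d079's (T-α) (the
  global edge point IS that transport), transported along the chosen edge path;
* `Hom.stabCondition_glob` — (PS2) for every edge abutting (as in the ambient category `SgA` of §§4–5).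

With `pointAligned_glob` / `glueCondition_glob` this completes the inputs of abc-iut-L3-t3's
`SgA.isTemperedCoveringOf_of_pointSystem_toCovObj` except the bijectivity of the point lift, which is
abc-iut-f-161's (TIE).  No `def`, no new `Prop`; nothing here takes a side on [IUTchIII] Cor. 3.12.
-/

noncomputable section

namespace Literature.AnabelianGeometry.SemiGraphs

open CategoryTheory CategoryTheory.Limits CategoryTheory.PreGaloisCategory
open Literature.AnabelianGeometry.Anabelioids

universe u

/-! ### Transport of stabilisers along an isomorphism of basepoints -/

section Transport

variable {C : Type*} [Category.{u} C] {G' G : C ⥤ FintypeCat.{u}}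

/-- **Stabilisers transport along an isomorphism of basepoints**: for `β : G' ≅ G` and `x ∈ G'(X)`,
the image of `Stab_{Aut G'}(x)` under `Aut(β)` is `Stab_{Aut G}(β x)` ([GeoAn] §1.1: change of basepoint
along a path). [cite: MochizukiGeoAn2004, Def. 1.1.2(ii) p.10] -/
theorem stabilizer_map_autMulEquivOfIso (β : G' ≅ G) (X : C) (x : G'.obj X) :
    (MulAction.stabilizer (Aut G') x).map (Aut.autMulEquivOfIso β).toMonoidHom =
      MulAction.stabilizer (Aut G) (β.hom.app X x) := by
  ext σ
  constructor
  · rintro ⟨τ, hτ, rfl⟩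
    rw [SetLike.mem_coe, MulAction.mem_stabilizer_iff, mulAction_def] at hτ
    rw [MulAction.mem_stabilizer_iff, mulAction_def]
    change (β.inv.app X ≫ τ.hom.app X ≫ β.hom.app X) (β.hom.app X x) = β.hom.app X x
    rw [FintypeCat.comp_apply, FintypeCat.comp_apply]
    erw [Iso.hom_inv_id_app_apply]
    rw [hτ]
  · intro hσ
    rw [MulAction.mem_stabilizer_iff, mulAction_def] at hσ
    refine ⟨(Aut.autMulEquivOfIso β).symm σ, ?_, (Aut.autMulEquivOfIso β).apply_symm_apply σ⟩
    rw [SetLike.mem_coe, MulAction.mem_stabilizer_iff, mulAction_def]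
    change (β.hom.app X ≫ σ.hom.app X ≫ β.inv.app X) x = x
    rw [FintypeCat.comp_apply, FintypeCat.comp_apply, hσ]
    exact Iso.hom_inv_id_app_apply β X x

end Transport

namespace SemiGraphOfAnabelioids

namespace Hom

variable {ℋ 𝒦 : SemiGraphOfAnabelioids.{u, u, u}} (ψ : Hom ℋ 𝒦) (A : 𝒦.BObj)
  [HasBinaryProducts 𝒦.BObj] (αψ : Over A ⥤ ℋ.BObj) [αψ.IsEquivalence]
  (eψ : ψ.pullbackFunctor ≅ Over.star A ⋙ αψ)

/-! ### (PS2) at vertices: local clause + (D1) + vertex alignment -/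

/-- **(PS2) at a vertex for an abstract covering**: for `ψ` LOCALLY the covering attached to `A`
(abc-iut-L3-t1 `IsFiniteEtaleCoveringOf`), with a global witness and VERTEX-ALIGNED, the vertex
homomorphism `Π_{ℋ,w} → Π_{𝒦,u}` of the profinite reading has image `Stab(y_w)`, the stabiliser of the
GLOBAL vertex point: its image is the stabiliser of the LOCAL base point (abc-iut-L3-t3 L1a), the global
decomposition group is `Stab_{Π_𝒦}(y_w)` ((D1), abc-iut-w4-d071 `range_pi1Map_eq_stabilizer'`), and
vertex alignment ties the two (abc-iut-w4-d079 `IsVertexAligned.stabilizer_eq_of_ranges`).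
[cite: MochizukiSemiAnbd2006, Rem. 2.2.1 p.24] -/
theorem range_hVProfinite_eq_stabilizer_yGlob (hloc : ψ.IsFiniteEtaleCoveringOf A)
    (hva : ψ.IsVertexAligned) (w : ℋ.graph.Vertex) :
    (ψ.over.hVProfinite w).toMonoidHom.range =
      MulAction.stabilizer (Aut (𝒦.fibV (ψ.base.vertexMap w))) (ψ.yGlob A αψ eψ w) := by
  -- (D1) at the canonical basepoint of `𝒦_u`, through the chosen path
  haveI : PreservesLimitsOfShape WalkingCospan (ℋ.ρ w) := preservesPullbacks_ρ ℋ w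
  haveI : PreservesLimitsOfShape WalkingCospan (ℋ.ρ w ⋙ ℋ.fibV w) := inferInstance
  haveI : (ℋ.ρ w ⋙ ℋ.fibV w).PreservesMonomorphisms := inferInstance
  haveI : Subsingleton ((ℋ.ρ w ⋙ ℋ.fibV w).obj (αψ.obj (Over.mk (𝟙 A)))) :=
    subsingleton_fibV_terminal A αψ w
  have hD1 := range_pi1Map_eq_stabilizer' αψ eψ (ℋ.ρ w ⋙ ℋ.fibV w)
    (Functor.isoWhiskerLeft (𝒦.ρ (ψ.base.vertexMap w)) (ψ.over.vertexPath w)) (tVGlob A αψ w)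
  -- the local clause at `w`: the image is the stabiliser of the local base point
  obtain ⟨-, cV, -, -, -, hV, -, -⟩ := hloc
  obtain ⟨αw, hαw, ⟨ew⟩⟩ := hV w
  haveI := hαw
  haveI : Mono (cV w).1.arrow := inferInstance
  obtain ⟨-, p₀, hp₀⟩ :=
    ψ.over.hVOfPath_injective_and_exists_range_eq_stabilizer w αw ew (ψ.over.vertexPath w)
  -- vertex alignment ties the two base points
  have hst := hva.stabilizer_eq_of_ranges w (ℋ.fibV w) (𝒦.fibV (ψ.base.vertexMap w))
    (ψ.over.vertexPath w) _ hD1 (cV w).1.arrow p₀ hp₀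
  change (ψ.over.hVOfPath w (ψ.over.vertexPath w)).toMonoidHom.range = _
  rw [hp₀]
  exact hst.symm

/-! ### (PS2) at edges: local clause + (D1) + branch and vertex alignment, via (T-α) -/

omit [HasBinaryProducts 𝒦.BObj] [αψ.IsEquivalence] in
/-- The LOCAL clause at an edge, read at an arbitrary presentation `pe : ψ e' = e` of the image edge
(bookkeeping: `subst`). [cite: MochizukiSemiAnbd2006, Def. 2.2(i) p.23] -/
theorem exists_local_edge_at (hloc : ψ.IsFiniteEtaleCoveringOf A) (e' : ℋ.graph.Edge)
    (e : 𝒦.graph.Edge) (pe : ψ.base.edgeMap e' = e) :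
    ∃ (Q : π₀Obj (A.T e)) (α : Over ((Q.1 : 𝒦.E e)) ⥤ ℋ.E e'),
      α.IsEquivalence ∧ Nonempty ((ψ.φE e' e pe).pullback ≅ Over.star (Q.1 : 𝒦.E e) ⋙ α) := by
  subst pe
  obtain ⟨-, -, cE, -, -, -, hE, -⟩ := hloc
  obtain ⟨α, hα, hne⟩ := hE e'
  exact ⟨cE e', α, hα, hne⟩

/-- **(PS2) at an edge with an abutting branch, at the presentation `ψ e(b') = e(ψ b')`**: for `ψ`
locally the covering attached to `A`, with a global witness, BRANCH- and VERTEX-ALIGNED, the edge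
homomorphism `Π_{ℋ,e'} → Π_{𝒦,e}` of the profinite reading has image `Stab(z_{e'})`: abc-iut-f-161's
`IsBranchAligned.edge_stabilizer_eq_of_global` (the transported global vertex point and the local edge
base point have the same stabiliser) and abc-iut-w4-d079's (T-α) (the global edge point IS that
transport), transported along the chosen edge path. [cite: MochizukiSemiAnbd2006, Rem. 2.2.1 p.24] -/
theorem range_hEAt_eq_stabilizer_zGlobAt (hloc : ψ.IsFiniteEtaleCoveringOf A)
    (hbr : ψ.IsBranchAligned) (hva : ψ.IsVertexAligned) (b' : ℋ.graph.Branch) (w : ℋ.graph.Vertex)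
    (h' : ℋ.graph.abuts b' = some w) :
    (ψ.over.hEAt (ℋ.graph.edgeOf b') (𝒦.graph.edgeOf (ψ.base.branchMap b'))
        (ψ.edgeMap_edgeOf_of_branchMap b' _ rfl)).toMonoidHom.range =
      MulAction.stabilizer (Aut (𝒦.fibE (𝒦.graph.edgeOf (ψ.base.branchMap b'))))
        (ψ.zGlobAt A αψ eψ (ℋ.graph.edgeOf b') (𝒦.graph.edgeOf (ψ.base.branchMap b'))
          (ψ.edgeMap_edgeOf_of_branchMap b' _ rfl)) := by
  -- (D1) at the INDUCED basepoint `ψ_w^* ⋙ F_w` (identity identification)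
  haveI : PreservesLimitsOfShape WalkingCospan (ℋ.ρ w) := preservesPullbacks_ρ ℋ w
  haveI : PreservesLimitsOfShape WalkingCospan (ℋ.ρ w ⋙ ℋ.fibV w) := inferInstance
  haveI : (ℋ.ρ w ⋙ ℋ.fibV w).PreservesMonomorphisms := inferInstance
  haveI : Subsingleton ((ℋ.ρ w ⋙ ℋ.fibV w).obj (αψ.obj (Over.mk (𝟙 A)))) :=
    subsingleton_fibV_terminal A αψ w
  have hD1 := range_pi1Map_eq_stabilizer' αψ eψ (ℋ.ρ w ⋙ ℋ.fibV w)
    (Functor.isoWhiskerLeft (𝒦.ρ (ψ.base.vertexMap w)) (Iso.refl ((ψ.φV w).pullback ⋙ ℋ.fibV w)))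
    (tVGlob A αψ w)
  -- the local vertex base point at the induced basepoint
  obtain ⟨-, cV, -, -, -, hV, -, -⟩ := _root_.id hloc
  obtain ⟨αw, hαw, ⟨ew⟩⟩ := hV w
  haveI := hαw
  haveI : Mono (cV w).1.arrow := inferInstance
  obtain ⟨-, p₀, hp₀⟩ := exists_range_transport_pi1Map_eq_stabilizer αw ew (ℋ.fibV w)
    (Iso.refl ((ψ.φV w).pullback ⋙ ℋ.fibV w))
  -- the local edge base point at the presentation `e(ψ b')`
  obtain ⟨Q, αe, hαe, ⟨ee⟩⟩ := ψ.exists_local_edge_at A hloc (ℋ.graph.edgeOf b')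
    (𝒦.graph.edgeOf (ψ.base.branchMap b')) (ψ.edgeMap_edgeOf_of_branchMap b' _ rfl)
  haveI := hαe
  haveI : Mono Q.1.arrow := inferInstance
  obtain ⟨-, q₀, hq₀⟩ := exists_range_transport_pi1Map_eq_stabilizer αe ee
    (ℋ.fibE (ℋ.graph.edgeOf b'))
    (Iso.refl ((ψ.φE (ℋ.graph.edgeOf b') (𝒦.graph.edgeOf (ψ.base.branchMap b'))
      (ψ.edgeMap_edgeOf_of_branchMap b' _ rfl)).pullback ⋙ ℋ.fibE (ℋ.graph.edgeOf b')))
  rw [range_autMulEquivOfIso_refl_comp] at hq₀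
  -- branch + vertex alignment: the transported global vertex point has the stabiliser of `q₀`
  have hst := hbr.edge_stabilizer_eq_of_global hva w (ℋ.fibV w) b' h' (ψ.base.branchMap b') rfl
    (ℋ.fibE (ℋ.graph.edgeOf b')) (ℋ.branchPath b' w h') _ hD1 (cV w).1.arrow p₀ hp₀ Q.1.arrow q₀ hq₀
  -- (T-α): that transported point is the re-indexed global edge point; transport along `γ_{e'}`
  rw [HomOver.hEAt, HomOver.hEOfPath_toMonoidHom, MonoidHom.range_comp]
  change Subgroup.map (Aut.autMulEquivOfIso (ψ.over.edgePath (ℋ.graph.edgeOf b')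
      (𝒦.graph.edgeOf (ψ.base.branchMap b')) (ψ.edgeMap_edgeOf_of_branchMap b' _ rfl))).toMonoidHom
      (pi1Map (ψ.φE (ℋ.graph.edgeOf b') (𝒦.graph.edgeOf (ψ.base.branchMap b'))
        (ψ.edgeMap_edgeOf_of_branchMap b' _ rfl)).pullback (ℋ.fibE (ℋ.graph.edgeOf b'))).range = _
  rw [hq₀, zGlobAt, ψ.globalBasePoint_edge_eq_transport_can A αψ eψ w b' h',
    ← stabilizer_map_autMulEquivOfIso]
  exact congrArg (fun H => Subgroup.map _ H) hst.symm

/-- **(PS2) at an edge with an abutting branch**, at the tautological presentation.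
[cite: MochizukiSemiAnbd2006, Rem. 2.2.1 p.24] -/
theorem range_hEAt_eq_stabilizer_zGlob (hloc : ψ.IsFiniteEtaleCoveringOf A)
    (hbr : ψ.IsBranchAligned) (hva : ψ.IsVertexAligned) (e' : ℋ.graph.Edge)
    (he' : ∃ (b' : ℋ.graph.Branch) (w : ℋ.graph.Vertex), ℋ.graph.edgeOf b' = e' ∧ ℋ.graph.abuts b' = some w) :
    (ψ.over.hEAt e' (ψ.base.edgeMap e') rfl).toMonoidHom.range =
      MulAction.stabilizer (Aut (𝒦.fibE (ψ.base.edgeMap e'))) (ψ.zGlob A αψ eψ e') := by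
  obtain ⟨b', w, rfl, h'⟩ := he'
  -- move to the presentation `e(ψ b')`
  have key : ∀ (e : 𝒦.graph.Edge) (pe : ψ.base.edgeMap (ℋ.graph.edgeOf b') = e),
      (ψ.over.hEAt (ℋ.graph.edgeOf b') e pe).toMonoidHom.range =
        MulAction.stabilizer (Aut (𝒦.fibE e)) (ψ.zGlobAt A αψ eψ (ℋ.graph.edgeOf b') e pe) →
      (ψ.over.hEAt (ℋ.graph.edgeOf b') (ψ.base.edgeMap (ℋ.graph.edgeOf b')) rfl).toMonoidHom.range =
        MulAction.stabilizer (Aut (𝒦.fibE (ψ.base.edgeMap (ℋ.graph.edgeOf b'))))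
          (ψ.zGlob A αψ eψ (ℋ.graph.edgeOf b')) := by
    intro e pe h
    subst pe
    exact h
  exact key _ _ (ψ.range_hEAt_eq_stabilizer_zGlobAt A αψ eψ hloc hbr hva b' w h')

/-- **(PS2), the stabiliser dictionary, at the global points** of an abstract four-clause covering whose
every edge has an abutting branch (as for the objects of the ambient category `SgA` of §§4–5).
[cite: MochizukiSemiAnbd2006, Rem. 2.2.1 p.24] -/
theorem stabCondition_glob (hloc : ψ.IsFiniteEtaleCoveringOf A) (hbr : ψ.IsBranchAligned)
    (hva : ψ.IsVertexAligned) (hab : ℋ.EveryEdgeAbuts) :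
    (BObj.toCovObj A).StabCondition ψ.toProfinite (ψ.yGlob A αψ eψ) (fun e' => ψ.zGlob A αψ eψ e') := by
  refine ⟨fun w => (ψ.over.hVProfinite_injective_and_exists_range_eq_stabilizer hloc w).1,
    fun w => ?_, fun e' => (ψ.over.hEAt_injective_and_exists_range_eq_stabilizer hloc e').1,
    fun e' => ?_⟩
  · rw [BObj.toCovObj_stabV_eq]
    exact ψ.range_hVProfinite_eq_stabilizer_yGlob A αψ eψ hloc hva w
  · rw [BObj.toCovObj_stabE_eq]
    exact ψ.range_hEAt_eq_stabilizer_zGlob A αψ eψ hloc hbr hva e' (hab e')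

end Hom

end SemiGraphOfAnabelioids

end Literature.AnabelianGeometry.SemiGraphs

end
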